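import Summits.ResolutionOfSingularities.ResolutionOfSingularities.Theorems.EquisingularLiftEquisingularLiftNatResidueHypDefsE11
import Literature.AlgebraicGeometry.Resolution.SncModelSpread
import Literature.AlgebraicGeometry.Resolution.SmoothGenericFibreSpread
import Literature.AlgebraicGeometry.Resolution.SmoothLocusBaseChange
import Literature.AlgebraicGeometry.Resolution.SpreadModelTower
import Literature.AlgebraicGeometry.Resolution.BlowupSequencesComapMarked
import Literature.AlgebraicGeometry.Motives.ProjBaseChangeAny
import HarnessLib

/-!
# EL♮(3) / EL♮(n), RUNG LC «large characteristic» — brick LC-SPREAD (s1)+(s2): THE SMOOTH-CENTRES WORD SPREADS FROM THE GENERIC FIBRE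
# to every flat base `A → B` inverting some `a ≠ 0`

leafhand-res-equisingularlift-3 g0 (prover, 2026-08-31; one-generation line-first hand on stmt-ResolutionOfSingularities-20148 / -20038 /
-15660, cell `pub/decomp-res`).  Crux `EquisingularLiftNatThree` (`stmt-…-20148`; uniform in `n`, so also `stmt-…-20038`), line W4.5(b), RUNG LC
(idea-2 g32 `Cruxes/EquisingularLiftNatThree/LARGE-CHAR-RUNG-idea2.md` v1.6 §(B3′) (s1) «`t` exists with `t.comap j_K = t_K`» (✓
`CentreSeq.exists_comap_eq_of_isPullback_generic`) and (s2) «every centre A-smooth after a shrink `A ↦ A[1/a]`» (✓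
`exists_forall_mem_smoothLocus_of_smooth_generic` + ✓ `smooth_pullback_snd_of_forall_mem_smoothLocus`, «stage by stage — exactly what
`SpreadModelDataSpread.exists_modelDataAt` does for BGMW model data»).  This file PROVES that recursion for the RUNG-LC currency
✓ `DescCentresSmoothOver` (…NatResidueHypDefsE10 :49), DEF-FREE (the shrinkable induction hypothesis is the universal statement over all flat
`A`-algebras `B` in which `a` is a unit, instead of a new point-wise predicate à la ✓ `CentreSeq.ModelDataAt`):

* `exists_forall_mem_smoothLocus_of_smooth_comap` — a closed subscheme `V(V) ⊆ X` whose generic fibre `V(j_K^*V) → Spec K` is SMOOTH is smooth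
  over `Spec A` at every point above some `D(b)`, `b ≠ 0` (✓ `exists_forall_mem_smoothLocus_of_isRegular_comap` with the regularity detour removed:
  ✓ `isPullback_subschemeMap_comap` + ✓ `exists_forall_mem_smoothLocus_of_smooth_generic`; no `CharZero K` needed);
* `specMap_mem_basicOpen_of_isUnit` — `Spec B → Spec A` lands in `D(b)` when `b` is a unit in `B`;
* `smooth_subschemeι_comap_of_forall_mem_smoothLocus` — point-wise smoothness above `D(b)` PACKAGES to `Smooth ((ι_B^*V).subschemeι ≫ q_B)` for every
  cartesian square `X_B = X ×_A Spec B` with `b ∈ Bˣ` (✓ `Scheme.Hom.preimage_smoothLocus_le_smoothLocus_of_isPullback`, Mathlib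
  `Scheme.Hom.smoothLocus_eq_top_iff`);
* ★ `CentreSeq.exists_forall_descCentresSmoothOver_comap` — **LC-SPREAD for centres**: `A` a Noetherian domain with fraction field `K`,
  `q : X → Spec A` of finite type with generic fibre `j_K : X_K → X` (any cartesian square), `s : CentreSeq X` whose induced sequence on the generic
  fibre has `K`-SMOOTH centres (`DescCentresSmoothOver (s.comap j_K) q_K` — the K-side output of ✓ `LargeChar.exists_centreSeq_descTransformOK`,
  …NatLargeCharStrongHyp, transported by (s1)); THEN there is `a ≠ 0` such that for EVERY flat `A`-algebra `B` with `a ∈ Bˣ` and every cartesian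
  square `X_B = X ×_A Spec B`, the induced sequence has `B`-smooth centres: `DescCentresSmoothOver (s.comap ι_B) q_B`.  Recursion: the blown-up
  stage has generic fibre the blown-up generic fibre (✓ `blowup.isPullback_comapMap`, `j_K` flat) and base change the blown-up base change
  (same lemma, `ι_B` flat), the two `a`'s multiply;
* ★ `exists_forall_descCentresSmoothOver_proj` — the same read on `X = ℙⁿ_A`, `X_K = ℙⁿ_K`, `X_B = ℙⁿ_B` with the standard squares
  (✓ `ProjBaseChangeRing.isPullback_projMap'`): the (s1)+(s2) half of `hspread` in the letters of ✓ `DescDoorAt` (whose `ExceptionalFlatOver` clause is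
  then free over the regular (B4) base by `CentreSeq.exceptionalFlatOver_of_descCentresSmoothOver`, companion file …NatDescWordRegularBase).

WHAT REMAINS of `hspread` after this file (honest): the k-FIBRE clause `DescTransformOK` of `DescDoorAt` at the points `θ` over `D(a)` — LC-FIB
(f1) «fibres of the B-side strict transforms = k-side strict transforms as sets», (f2)/(s3) centre ⊆ running transform, (f3) the position token,
(f4) END — and the (B5) assembly; nothing here touches them.  EL♮(3) NOT proved; EL♮ NOT proved; resolution of singularities in positive
characteristic NOT proved; nothing of [Hironaka2017] (a candidate under adjudication) is asserted or used.  [OURS · EGA IV₃ §8–9 spreading-out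
bookkeeping over tree lemmas · standard axioms · DEF-FREE · `--supports stmt-ResolutionOfSingularities-20148 --as helper`, counted 0 · AI-written,
weaker than expert review.] [cite: Grothendieck1966, EGA IV₃ §8–§9 (spreading out)] [cite: StacksProject, Tag 0805] (method; index only)
-/

set_option linter.dupNamespace false -- mandated namespace `Summit.<Summit>.<Problem>` of this single-conjunct summit

noncomputable section

open CategoryTheory CategoryTheory.Limits AlgebraicGeometry TopologicalSpace PrimeSpectrum
open MvPolynomial
open Literature.AlgebraicGeometry.Resolution
open Literature.AlgebraicGeometry.Motives
open AlgebraicGeometry.Scheme.IdealSheafData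

namespace Summit.ResolutionOfSingularities.ResolutionOfSingularities.Cruxes.EquisingularLiftNat.Sections

/-! ## One closed subscheme: smoothness spreads from the generic fibre and packages over `B` -/

section OneCentre

variable {A : Type} [CommRing A] [IsDomain A] [IsNoetherianRing A] (K : Type) [Field K] [Algebra A K] [IsFractionRing A K]
  {X XK : Scheme.{0}} (q : X ⟶ Spec (.of A)) [LocallyOfFiniteType q] [QuasiCompact q]
  {jK : XK ⟶ X} {qK : XK ⟶ Spec (.of K)} (HK : IsPullback jK qK q (specOfAlgebra A K))

include HK in
/-- **A closed subscheme with SMOOTH generic fibre is smooth over `Spec A` above some `D(b)`, `b ≠ 0`**: the generic fibre of `V(V) → Spec A`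
is `V(j_K^*V) → Spec K` (✓ `isPullback_subschemeMap_comap`), assumed smooth, and smoothness spreads (✓ `exists_forall_mem_smoothLocus_of_smooth_generic`,
Chevalley on the non-smooth locus).  (✓ `exists_forall_mem_smoothLocus_of_isRegular_comap` without the `CharZero` regular ⇒ smooth detour.)
[cite: Grothendieck1966, EGA IV₃ §8–§9] [folklore] -/
theorem exists_forall_mem_smoothLocus_of_smooth_comap (V : X.IdealSheafData) (hsmK : Smooth ((V.comap jK).subschemeι ≫ qK)) :
    ∃ b : A, b ≠ 0 ∧ ∀ z : V.subscheme,
      (V.subschemeι ≫ q) z ∈ (basicOpen b : Set (PrimeSpectrum A)) → z ∈ (V.subschemeι ≫ q).smoothLocus := by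
  haveI : IsLocallyNoetherian X := LocallyOfFiniteType.isLocallyNoetherian q
  haveI : CompactSpace X := QuasiCompact.compactSpace_of_compactSpace q
  haveI : IsLocallyNoetherian V.subscheme := LocallyOfFiniteType.isLocallyNoetherian V.subschemeι
  haveI : CompactSpace V.subscheme := QuasiCompact.compactSpace_of_compactSpace V.subschemeι
  haveI : IsNoetherian V.subscheme := {}
  -- the generic fibre of `V(V) → Spec A` is `V(jK^*V)`, smooth over `K`
  have H := isPullback_subschemeMap_comap K q V HK
  have hsm : Smooth (pullback.snd (V.subschemeι ≫ q) (specOfAlgebra A K)) := by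
    have he : pullback.snd (V.subschemeι ≫ q) (specOfAlgebra A K) = H.isoPullback.inv ≫ ((V.comap jK).subschemeι ≫ qK) :=
      (Iso.eq_inv_comp _).mpr H.isoPullback_hom_snd
    rw [he]
    haveI := hsmK
    infer_instance
  exact exists_forall_mem_smoothLocus_of_smooth_generic K (V.subschemeι ≫ q) hsm

omit [IsDomain A] [IsNoetherianRing A] in
/-- `Spec B → Spec A` lands in `D(b)` when `b` is a unit in `B` (a unit lies in no prime). [folklore] -/
theorem specMap_mem_basicOpen_of_isUnit (B : Type) [CommRing B] [Algebra A B] {b : A} (hb : IsUnit (algebraMap A B b))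
    (y : Spec (.of B)) : specOfAlgebra A B y ∈ (basicOpen b : Set (PrimeSpectrum A)) := by
  change PrimeSpectrum.comap (algebraMap A B) y ∈ basicOpen b
  rw [mem_basicOpen, comap_asIdeal, Ideal.mem_comap]
  exact fun h => y.2.ne_top (Ideal.eq_top_of_isUnit_mem _ h hb)

omit [IsDomain A] [QuasiCompact q] in
/-- **Point-wise smoothness above `D(b)` packages to smoothness over every base in which `b` is a unit**: if every point of `V(C)` above `D(b)`
is a smooth point of `V(C) → Spec A`, then for every `A`-algebra `B` with `b ∈ Bˣ` and every cartesian square `X_B = X ×_{Spec A} Spec B`, the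
pulled-back centre `V(ι_B^*C) → Spec B` is smooth (it is the base change of `V(C) → Spec A`, ✓ `isPullback_subschemeMap_comap`; its points map
above `D(b)`; ✓ `Scheme.Hom.preimage_smoothLocus_le_smoothLocus_of_isPullback`). [cite: Grothendieck1967, Prop. 17.7.4] [folklore] -/
theorem smooth_subschemeι_comap_of_forall_mem_smoothLocus (C : X.IdealSheafData) {b : A}
    (hb : ∀ z : C.subscheme, (C.subschemeι ≫ q) z ∈ (basicOpen b : Set (PrimeSpectrum A)) → z ∈ (C.subschemeι ≫ q).smoothLocus)
    (B : Type) [CommRing B] [Algebra A B] (hunit : IsUnit (algebraMap A B b))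
    {XB : Scheme.{0}} {ιB : XB ⟶ X} {qB : XB ⟶ Spec (.of B)} (HX : IsPullback ιB qB q (specOfAlgebra A B)) :
    Smooth ((C.comap ιB).subschemeι ≫ qB) := by
  have hsq := isPullback_subschemeMap_comap B q C HX
  haveI : LocallyOfFinitePresentation ((C.comap ιB).subschemeι ≫ qB) := MorphismProperty.of_isPullback hsq inferInstance
  rw [← Scheme.Hom.smoothLocus_eq_top_iff]
  refine top_le_iff.mp fun p _ => ?_
  apply Scheme.Hom.preimage_smoothLocus_le_smoothLocus_of_isPullback hsq
  change subschemeMap (C.comap ιB) C ιB (C.le_map_comap ιB) p ∈ (C.subschemeι ≫ q).smoothLocus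
  apply hb
  rw [← Scheme.Hom.comp_apply, hsq.w, Scheme.Hom.comp_apply]
  exact specMap_mem_basicOpen_of_isUnit B hunit _

end OneCentre

/-! ## The recursion along a multiple blow-up -/

section Spread

variable {A : Type} [CommRing A] [IsDomain A] [IsNoetherianRing A] (K : Type) [Field K] [Algebra A K] [IsFractionRing A K]

/-- ★ **LC-SPREAD for centres — the smooth-centres word spreads from the generic fibre to every flat base inverting some `a ≠ 0`.**  For
`q : X → Spec A` of finite type over a Noetherian domain with generic fibre `j_K : X_K → X` and `s : CentreSeq X` with
`DescCentresSmoothOver (s.comap j_K) q_K`, there is `a ≠ 0` such that `DescCentresSmoothOver (s.comap ι_B) q_B` for every FLAT `A`-algebra `B`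
with `a ∈ Bˣ` and every cartesian square `X_B = X ×_{Spec A} Spec B`.  Induction on `s`: the first centre by
`exists_forall_mem_smoothLocus_of_smooth_comap` + `smooth_subschemeι_comap_of_forall_mem_smoothLocus`; the tail over the blown-up stage
`Bl_C X → Spec A`, whose generic fibre is `Bl_{j_K^*C} X_K` and whose base change to `B` is `Bl_{ι_B^*C} X_B` (✓ `blowup.isPullback_comapMap` for the
flat `j_K`, `ι_B`) — which is exactly how ✓ `CentreSeq.comap` forms the induced sequence; the two `a`'s multiply.
[cite: Grothendieck1966, EGA IV₃ §8–§9] [cite: StacksProject, Tag 0805] [OURS · L1 W4.5b · RUNG LC (B3′)(s1)(s2); EL♮(3) NOT proved] -/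
theorem CentreSeq.exists_forall_descCentresSmoothOver_comap :
    ∀ {X XK : Scheme.{0}} [IsLocallyNoetherian XK] (s : CentreSeq X) (q : X ⟶ Spec (.of A))
      [LocallyOfFiniteType q] [QuasiCompact q] (jK : XK ⟶ X) (qK : XK ⟶ Spec (.of K)) [LocallyOfFiniteType qK],
      IsPullback jK qK q (specOfAlgebra A K) → DescCentresSmoothOver (s.comap jK) qK →
      ∃ a : A, a ≠ 0 ∧ ∀ (B : Type) [CommRing B] [Algebra A B] [Module.Flat A B], IsUnit (algebraMap A B a) →
        ∀ {XB : Scheme.{0}} (ιB : XB ⟶ X) (qB : XB ⟶ Spec (.of B)), IsPullback ιB qB q (specOfAlgebra A B) →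
          DescCentresSmoothOver (s.comap ιB) qB
  | _, _, _, .nil _, _, _, _, _, _, _, _, _ =>
    ⟨1, one_ne_zero, fun B _ _ _ _ XB ιB qB _ => by simp [DescCentresSmoothOver]⟩
  | X, XK, _, .cons C rest, q, _, _, jK, qK, _, HK, hsm => by
    haveI : IsLocallyNoetherian X := LocallyOfFiniteType.isLocallyNoetherian q
    haveI : Flat jK := flat_of_isPullback_generic K q HK
    haveI : IsProper (blowup.π C) := (blowup.isBlowup C).isProper
    haveI : IsLocallyNoetherian (blowup C) := LocallyOfFiniteType.isLocallyNoetherian (blowup.π C)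
    haveI : IsProper (blowup.π (C.comap jK)) := (blowup.isBlowup (C.comap jK)).isProper
    haveI : IsLocallyNoetherian (blowup (C.comap jK)) := LocallyOfFiniteType.isLocallyNoetherian (blowup.π (C.comap jK))
    -- the generic fibre of the blown-up stage
    set g : blowup (C.comap jK) ⟶ blowup C := blowup.comapMap C jK with hg
    have HK₁ : IsPullback g (blowup.π (C.comap jK) ≫ qK) (blowup.π C ≫ q) (specOfAlgebra A K) :=
      (blowup.isPullback_comapMap C jK).paste_vert HK
    haveI : LocallyOfFiniteType (blowup.π C ≫ q) := inferInstance
    haveI : QuasiCompact (blowup.π C ≫ q) := inferInstance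
    haveI : LocallyOfFiniteType (blowup.π (C.comap jK) ≫ qK) := inferInstance
    -- the generic data: a smooth first centre and the induced tail
    rw [CentreSeq.comap_cons] at hsm
    have hsmK : Smooth ((C.comap jK).subschemeι ≫ qK) := hsm.1
    have hrestK : DescCentresSmoothOver (rest.comap g) (blowup.π (C.comap jK) ≫ qK) := hsm.2
    -- (1) the first centre spreads
    obtain ⟨a₁, ha₁, h₁⟩ := exists_forall_mem_smoothLocus_of_smooth_comap K q HK C hsmK
    -- (2) the tail spreads over the blown-up stage
    obtain ⟨a₂, ha₂, h₂⟩ := CentreSeq.exists_forall_descCentresSmoothOver_comap rest (blowup.π C ≫ q) g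
      (blowup.π (C.comap jK) ≫ qK) HK₁ hrestK
    refine ⟨a₁ * a₂, mul_ne_zero ha₁ ha₂, fun B _ _ _ hunit XB ιB qB HX => ?_⟩
    rw [map_mul] at hunit
    -- `Spec B → Spec A` is flat, hence so is `ι_B`, and the blown-up square over `B` is cartesian
    haveI : Flat (specOfAlgebra A B) := by
      rw [Flat.SpecMap_iff, CommRingCat.hom_ofHom]
      exact RingHom.flat_algebraMap_iff.mpr inferInstance
    haveI : Flat ιB := MorphismProperty.of_isPullback HX.flip ‹Flat (specOfAlgebra A B)›
    have H1 : IsPullback (blowup.comapMap C ιB) (blowup.π (C.comap ιB) ≫ qB) (blowup.π C ≫ q) (specOfAlgebra A B) :=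
      (blowup.isPullback_comapMap C ιB).paste_vert HX
    rw [CentreSeq.comap_cons]
    exact ⟨smooth_subschemeι_comap_of_forall_mem_smoothLocus q C h₁ B (isUnit_of_mul_isUnit_left hunit) HX,
      h₂ B (isUnit_of_mul_isUnit_right hunit) _ _ H1⟩

end Spread

/-! ## On projective space: the (s1)+(s2) half of `hspread` in the letters of `DescDoorAt` -/

section Proj

variable (A : Type) [CommRing A] [IsDomain A] [IsNoetherianRing A] (K : Type) [Field K] [Algebra A K] [IsFractionRing A K] (n : ℕ)

/-- ★ **LC-SPREAD for centres on `ℙⁿ`**: for a Noetherian domain `A` with fraction field `K` and a word `t_K : CentreSeq ℙⁿ_K` with `K`-SMOOTH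
centres (`DescCentresSmoothOver t_K q_K`; e.g. the K-side output of ✓ `LargeChar.exists_centreSeq_descTransformOK`), there are a MODEL `s : CentreSeq ℙⁿ_A`
with `s.comap (ℙⁿ_K → ℙⁿ_A) = t_K` (✓ `CentreSeq.exists_comap_eq_of_isPullback_generic`) and `a ≠ 0` such that for every FLAT `A`-algebra `B` with
`a ∈ Bˣ` (every further localisation `A[1/(a a')]`, in particular the smooth (B4) base) the induced word on `ℙⁿ_B` has `B`-SMOOTH centres:
`DescCentresSmoothOver (s.comap (ℙⁿ_B → ℙⁿ_A)) q_B` — the (s1)+(s2) clauses of `hspread`, read in the letters of ✓ `DescDoorAt B k θ n H ι`.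
Squares: ✓ `ProjBaseChangeRing.isPullback_projMap'` (any algebra).
[cite: Grothendieck1966, EGA IV₃ §8–§9] [cite: Liu2002, Prop. 3.1.9 and Ex. 3.1.10] [OURS · L1 W4.5b · RUNG LC (B3′)(s1)(s2); EL♮(3) NOT proved] -/
theorem exists_forall_descCentresSmoothOver_proj
    (tK : letI := MvPolynomial.gradedAlgebra (σ := Fin (n + 1)) (R := K)
      CentreSeq (Proj (homogeneousSubmodule (Fin (n + 1)) K)))
    (htK : letI := MvPolynomial.gradedAlgebra (σ := Fin (n + 1)) (R := K)
      DescCentresSmoothOver tK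
        (Proj.toSpecZero (homogeneousSubmodule (Fin (n + 1)) K) ≫
          Spec.map (CommRingCat.ofHom (algebraMap K (homogeneousSubmodule (Fin (n + 1)) K 0))))) :
    letI := MvPolynomial.gradedAlgebra (σ := Fin (n + 1)) (R := A)
    letI := MvPolynomial.gradedAlgebra (σ := Fin (n + 1)) (R := K)
    ∃ (s : CentreSeq (Proj (homogeneousSubmodule (Fin (n + 1)) A))) (a : A),
      s.comap (Proj.map (ProjBaseChangeRing.mapGraded A K (Fin (n + 1))) (ProjBaseChangeRing.irrelevant_le_map A K (Fin (n + 1)))) = tK ∧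
      a ≠ 0 ∧
      ∀ (B : Type) [CommRing B] [Algebra A B] [Module.Flat A B], IsUnit (algebraMap A B a) →
        letI := MvPolynomial.gradedAlgebra (σ := Fin (n + 1)) (R := B)
        DescCentresSmoothOver
          (s.comap (Proj.map (ProjBaseChangeRing.mapGraded A B (Fin (n + 1))) (ProjBaseChangeRing.irrelevant_le_map A B (Fin (n + 1)))))
          (Proj.toSpecZero (homogeneousSubmodule (Fin (n + 1)) B) ≫
            Spec.map (CommRingCat.ofHom (algebraMap B (homogeneousSubmodule (Fin (n + 1)) B 0)))) := by
  letI := MvPolynomial.gradedAlgebra (σ := Fin (n + 1)) (R := A)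
  letI := MvPolynomial.gradedAlgebra (σ := Fin (n + 1)) (R := K)
  -- the structure morphisms and the generic square
  set qA : Proj (homogeneousSubmodule (Fin (n + 1)) A) ⟶ Spec (.of A) :=
    Proj.toSpecZero (homogeneousSubmodule (Fin (n + 1)) A) ≫
      Spec.map (CommRingCat.ofHom (algebraMap A (homogeneousSubmodule (Fin (n + 1)) A 0))) with hqA
  set qK : Proj (homogeneousSubmodule (Fin (n + 1)) K) ⟶ Spec (.of K) :=
    Proj.toSpecZero (homogeneousSubmodule (Fin (n + 1)) K) ≫
      Spec.map (CommRingCat.ofHom (algebraMap K (homogeneousSubmodule (Fin (n + 1)) K 0))) with hqK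
  set jK : Proj (homogeneousSubmodule (Fin (n + 1)) K) ⟶ Proj (homogeneousSubmodule (Fin (n + 1)) A) :=
    Proj.map (ProjBaseChangeRing.mapGraded A K (Fin (n + 1))) (ProjBaseChangeRing.irrelevant_le_map A K (Fin (n + 1))) with hjK
  have HK : IsPullback jK qK qA (specOfAlgebra A K) := ProjBaseChangeRing.isPullback_projMap' A K
  -- `ℙⁿ_A → Spec A` is of finite type (smooth and proper), `ℙⁿ_K` is locally Noetherian
  obtain ⟨hsmA, hprA⟩ := Summit.ResolutionOfSingularities.ResolutionOfSingularities.Cruxes.EquisingularLift.StrataSplit.stub_projectiveAmbientSmoothProper A n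
  obtain ⟨hsmK', -⟩ := Summit.ResolutionOfSingularities.ResolutionOfSingularities.Cruxes.EquisingularLift.StrataSplit.stub_projectiveAmbientSmoothProper K n
  haveI := hsmA
  haveI := hprA
  haveI := hsmK'
  haveI : LocallyOfFiniteType qA := inferInstance
  haveI : QuasiCompact qA := inferInstance
  haveI : LocallyOfFiniteType qK := inferInstance
  haveI : IsLocallyNoetherian (Proj (homogeneousSubmodule (Fin (n + 1)) K)) := LocallyOfFiniteType.isLocallyNoetherian qK
  -- (s1) the model, (s2) the spread
  obtain ⟨s, hs⟩ := CentreSeq.exists_comap_eq_of_isPullback_generic K tK qA jK qK HK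
  have hsm : DescCentresSmoothOver (s.comap jK) qK := by rw [hs]; exact htK
  obtain ⟨a, ha, h⟩ := CentreSeq.exists_forall_descCentresSmoothOver_comap K s qA jK qK HK hsm
  refine ⟨s, a, hs, ha, fun B _ _ _ hunit => ?_⟩
  letI := MvPolynomial.gradedAlgebra (σ := Fin (n + 1)) (R := B)
  exact h B hunit _ _ (ProjBaseChangeRing.isPullback_projMap' A B)

end Proj

end Summit.ResolutionOfSingularities.ResolutionOfSingularities.Cruxes.EquisingularLiftNat.Sections

end
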